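/-
Copyright (c) 2026 the pub-hodgecm-mathlib formalisation cell (harness21).  Prover seat hodgecm-mathlib-R90-C14-p04 (g0) (free R90-TF hand routed to L1 by
CHAIR VALVE WORD W4), Track B «K2-LIT» ∕ hLiu418 #184♮, Road I v3, unit U5 «THE CLOSE»: FACE-D₀ row `h2₂` «line lifts have rank ≤ 1» — (B5-fin) in the
GLOBAL-INTERTWINER form ((B1c′) census; LEAD F0P6-plan (g14) BATCH #167 (3) «(B1c′) core stays C14-p04's»).  THEOREMS ONLY.  2026-09-04/05.
-/
import Summits.HodgeConjecture.HodgeConjecture.Theorems.K2LiuFirstTermLineLiftRankRow   -- ★ p862821 (B4): `fourierCoeffDelta_thetaLift_pairRep_unipDelta`, §2 `coeff_comp_codRestrict_thetaFunctional_eq_zero`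
import Summits.HodgeConjecture.HodgeConjecture.Theorems.K2LiuRankOneLineGram           -- ★ U2c file 1 §1′: `eq_zero_of_functional_rankTwo_conj` (σ-twin of ★ U2a's head)
import HarnessLib

/-!
# K2_Liu road (hLiu418 = stmt-HodgeConjecture-24832), Road I v3, U5 «THE CLOSE», FACE-D₀ row `h2₂`, (B5-fin) GLOBAL-INTERTWINER FORM:
# `Λ_S ≡ 0` from ONE model letter «in the `Tg`-model the finite Siegel unipotents act on pure tensors by the chirp multiplier in the finite slot»

Cell `pub/hodgecm-mathlib` (D-0151), Track B, build stream 29; helper lane `--supports stmt-HodgeConjecture-24832 --as helper`, count-neutral.  Companion of ★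
`K2LiuFirstTermLineLiftRankRowModel` (p863026 ED. 1 ∕ p863240 ED. 2; this is its «ED. 3», filed as its own module because the host reached the 400-line cap).
WHY ((B1c′) census, R90∕K2 bus 23:43Z–23:50Z).  In the tree's model of `pairRep` (Schrödinger model of `adelicGram`, the CM real∕imaginary polarisation) the
doubled group's Siegel parabolic `P_Δ` is NOT inside the model's `P_𝕐`; ★ (K-f) `K2LiuDoubledParabolicCayleyModel` moves it there by the CAYLEY MOVER — the
GLOBAL operator `ω(r_F κ_n)` (★ `ratThetaLiftContι`, characterised as the Θ-fixing lift; no arch ⊗ fin factorisation by name) — after which a Siegel unipotent acts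
by the chirp `ω(𝐫₀ q)` (★ `coe_toOp_adelicSiegelLift`), whose archimedean factor is `1` for a FINITE unipotent.  So the instantiable intertwiner is a linear
automorphism `Tg` of the WHOLE `𝒮(𝔸^{n″})`, and the one model letter is
`hκ : Tg (ω(toDiagA (ι z), 1) (Tg⁻¹ (Φ_∞ ⊗ φ))) = Φ_∞ ⊗ ρf z φ` (ED. 1 = the case `Tg = 1`; ED. 2 = `Tg = 1 ⊗ Tκ`).
* **`fourierCoeffDelta_thetaLift_eq_zero_of_finLineModel_conj`** — `∀ Φ, cf_S(Θ̃_Φ(fw))(1) = 0`: `Λ^κ := Λ_S ∘ Tg⁻¹`; `φ ↦ Λ^κ(Φ_∞ ⊗ φ)` is `(Z, χ)`-semi-invariant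
  for the σ-explicit multiplier model `ρf` (`hκ` + ★ p862821 quasi-invariance of `Λ_S` at the vector `Tg⁻¹(Φ_∞ ⊗ φ)` + `hχS`), hence `0` by ★ U2a (σ-twin);
  pure tensors generate (★ `piSchwartzBruhatEquiv`, `TensorProduct.induction_on`), so `Λ^κ = 0` and `Λ_S Φ = Λ^κ(Tg Φ) = 0`.
* **`h2Row_thetaSide_of_finLineModel_conj`** — the FACE-D′ bytes `cfS ∘ₗ codRestrict P T₂ hP₂ = 0` (★ p862821 §2 ∘ the above).
LETTERS left BY VALUE after this file: `Tg`∕`hκ` (the κ-model of ★ (K-f) read on the LINE pair `pairRep … (chiSplittingLine …)` and on pure tensors — census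
(B1c′) core), the σ-explicit line model's structure letters `hb hπ hψ hχ∕hχS` (S, → K2E3-p23 `K2LiuFirstTermLineLiftRankRowSmallLetters`), the linear readings
`Bl`∕`cfS` (★ (t)∕(c) instances).
No definition, no instance, no notation, no named-fact hypothesis, no `sorry`; axioms ⊆ {propext, Classical.choice, Quot.sound}.  HONEST LABEL: HC_CM is proved only modulo
the 7 printed citations (2 remaining named inputs: hLiu418 = stmt-HodgeConjecture-24832, h413 = stmt-HodgeConjecture-24833) until rung 0 closes; this file moves no counter.

References: [Rallis1984] S. Rallis, Compositio Math. 51 (1984) §4; [Kudla1986] S. S. Kudla, Invent. Math. 83 (1986) proof of Thm. 2.8; [KudlaRallis1994] S. Kudla,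
S. Rallis, Ann. of Math. 140 (1994) §3; [Weil1964] A. Weil, Acta Math. 111 (1964) Chap. I n° 13 p. 160, Chap. III n° 37–38 pp. 188–190; [Kudla1994] S. Kudla, Israel
J. Math. 87 (1994) §3; [Liu2021] Y. Liu, Camb. J. Math. 9 (2021) App. B Prop. B.8 p. 104.
-/

set_option autoImplicit false
set_option linter.dupNamespace false
-- statements over the adelic dual-pair carriers elaborate to very large types; elaborate sequentially (as in ★ `K2LiuLineThetaFunctionalOfRecord`)
set_option Elab.async false

noncomputable section

open NumberField NumberField.mixedEmbedding MeasureTheory IsDedekindDomain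
open scoped Matrix ComplexOrder ENNReal TensorProduct SchwartzMap Classical  -- `Classical`: the `Fintype` of real ∕ complex places inside `mixedSpace (L⁺)` (as ★ p862586)

namespace Summit.HodgeConjecture.HodgeConjecture.Cruxes.HLiu418.K2LiuFirstTermLineLiftRankRowModelConj

open Literature.NumberTheory.Automorphic Literature.NumberTheory.Automorphic.UnitaryGroup
open Literature.NumberTheory.Automorphic.IdeleClassGroup
open Literature.NumberTheory.Automorphic.Liu2021
open Literature.NumberTheory.Automorphic.Liu2021.Def411WeilCarriers
open Literature.NumberTheory.Automorphic.Liu2021.Def411WeilCarriersDoubling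
open Literature.NumberTheory.GelbartRogawski1991 Literature.NumberTheory.GelbartRogawski1991.UnitaryDualPair
open Literature.NumberTheory.GelbartRogawski1991.GRConstruction
open Literature.NumberTheory.GaloisRepresentations
open Literature.NumberTheory.Weil1964
open Literature.RepresentationTheory Literature.RepresentationTheory.Liu2021
open Literature.NumberTheory.K2Lit.DoubledLineTheta Literature.NumberTheory.K2Lit.SiegelDoubled
open Literature.MeasureTheory.Group
open Summit.HodgeConjecture.HodgeConjecture.Cruxes.HLiu418.K2LiuSiegelUnipotentFourierDefs
open Summit.HodgeConjecture.HodgeConjecture.Cruxes.HLiu418.K2LiuSiegelUnipotentCharacters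
open Summit.HodgeConjecture.HodgeConjecture.Cruxes.HLiu418.K2LiuUnipotentCoveringWeight
open Summit.HodgeConjecture.HodgeConjecture.Cruxes.HLiu418.K2LiuFirstTermLineLiftRankRow
open Summit.HodgeConjecture.HodgeConjecture.Cruxes.HLiu418.K2LiuRankOneLineGram (eq_zero_of_functional_rankTwo_conj)

variable (L : Type) [Field L] [NumberField L] [IsCMField L]
variable {N n : ℕ} (e : Fin N × Fin 1 ≃ Fin n)
  (dV : Fin N → L) (hdV : ∀ i, IsCMField.complexConj L (dV i) = dV i)
  (dW : Fin 1 → L) (hdW : ∀ i, IsCMField.complexConj L (dW i) = dW i)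
  {n'' : ℕ} (e₁ : Fin (n + n) × Fin 1 ≃ Fin n'')
  (hdV0 : ∀ i, dV i ≠ 0) (hdW0 : ∀ i, dW i ≠ 0)
  (lam : IdeleClassGroup L →ₜ* Circle) (hlam : IsConjugateSymplectic L lam) (a' : (Fp L)ˣ)
  (hρ : HasThetaMajorants fun
      (p : ↥(UnitaryGroup.adelic (Fp L) L (IsCMField.complexConj L) (n + n) (Matrix.diagonal (dD L e dV hdV dW hdW))) ×
        ↥(UnitaryGroup.adelic (Fp L) L (IsCMField.complexConj L) 1 (JW (Fp L) L a')))
      (Φ : piSchwartzBruhat (Fp L) (Fin n'')) =>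
        pairRep (Fp L) L (IsCMField.complexConj L) (n + n) 1 e₁ (Matrix.diagonal (dD L e dV hdV dW hdW)) (JW (Fp L) L a')
          (chiSplittingLine L e₁ (dD L e dV hdV dW hdW) (dD_conj L e dV hdV dW hdW) (dD_ne_zero L e dV hdV dW hdW hdV0 hdW0)
            (toHeckeCharacter L lam) (isUnitary_toHeckeCharacter L lam)
            ((isOscillatorChar_toHeckeCharacter_iff lam).mpr hlam) (TW (Fp L) a')
            (isUnit_det_TW (Fp L) a') (JW (Fp L) L a') (JW_eq (Fp L) L a'))
          p Φ)
  [MeasurableSpace (↥(UnitaryGroup.adelic (Fp L) L (IsCMField.complexConj L) 1 (JW (Fp L) L a')) ⧸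
    (UnitaryGroup.toAdelic (Fp L) L (IsCMField.complexConj L) 1 (JW (Fp L) L a')).range)]
  [BorelSpace (↥(UnitaryGroup.adelic (Fp L) L (IsCMField.complexConj L) 1 (JW (Fp L) L a')) ⧸
    (UnitaryGroup.toAdelic (Fp L) L (IsCMField.complexConj L) 1 (JW (Fp L) L a')).range)]
  (μW : Measure (↥(UnitaryGroup.adelic (Fp L) L (IsCMField.complexConj L) 1 (JW (Fp L) L a')) ⧸
    (UnitaryGroup.toAdelic (Fp L) L (IsCMField.complexConj L) 1 (JW (Fp L) L a')).range)) [IsFiniteMeasure μW]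
  (fw : C(↥(UnitaryGroup.adelic (Fp L) L (IsCMField.complexConj L) 1 (JW (Fp L) L a')) ⧸
    (UnitaryGroup.toAdelic (Fp L) L (IsCMField.complexConj L) 1 (JW (Fp L) L a')).range, ℂ))
  [MeasurableSpace (unipDelta L e dV hdV dW hdW)] [BorelSpace (unipDelta L e dV hdV dW hdW)]
  (νN : Measure (unipDelta L e dV hdV dW hdW)) [νN.IsMulLeftInvariant]
  {βw : unipDelta L e dV hdV dW hdW → ℝ≥0∞} (hβ : IsCoveringWeight (unipDeltaRat L e dV hdV dW hdW) βw) (hβtop : ∫⁻ u, βw u ∂νN ≠ ∞)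
  (S : Matrix (Fin n) (Fin n) L)

/-! ## The letters: linear readings of the lift and of the coefficient, and the σ-explicit line model on `𝒮(𝔸_f^{n″})` -/

variable
  -- (i) ★ (t): the lift as a linear map of `Φ`, and ★ (c): the coefficient as a linear map on a class `P ∋ Bl Φ`
  (Bl : ↥(piSchwartzBruhat (Fp L) (Fin n'')) →ₗ[ℂ] (HA L e dV hdV dW hdW → ℂ))
  (hBl : ∀ (Φ : piSchwartzBruhat (Fp L) (Fin n'')) (h : HA L e dV hdV dW hdW),
    Bl Φ h = doubledLineThetaLift L e dV hdV dW hdW e₁ hdV0 hdW0 lam hlam a' hρ μW Φ fw h)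
  (P : Submodule ℂ (HA L e dV hdV dW hdW → ℂ)) (hPB : ∀ Φ, Bl Φ ∈ P) (cfS : ↥P →ₗ[ℂ] (HA L e dV hdV dW hdW → ℂ))
  (hcf : ∀ (y : ↥P) (h : HA L e dV hdV dW hdW), cfS y h = fourierCoeffDelta L e dV hdV dW hdW νN βw S (y : HA L e dV hdV dW hdW → ℂ) h)
  -- (ii) the σ-explicit line model at one finite place, on the finite-adelic Schwartz–Bruhat space (★ U2a §1′ binders verbatim)
  {R : Type*} [CommRing R] {F : Type*} [Field F] [Algebra F R]
  (σ : R →+* R) (hσ : ∀ x, σ (σ x) = x) (hσF : ∀ c : F, σ (algebraMap F R c) = algebraMap F R c)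
  (π : Matrix (Fin 2) (Fin 2) R →ₗ[F] Matrix (Fin 2) (Fin 2) R →ₗ[F] F)
  (hπ : ∀ H : Matrix (Fin 2) (Fin 2) R, (H.map σ)ᵀ = H → H ≠ 0 → ∃ s : Matrix (Fin 2) (Fin 2) R, (s.map σ)ᵀ = s ∧ π s H ≠ 0)
  (ψ : AddChar F Circle) (hψ : ∃ t : F, ((ψ t : Circle) : ℂ) ≠ 1)
  {Z : Type*} [Group Z] (ρf : Representation ℂ Z (FinSB (Fp L) (Fin n'')))
  (b : Z → Matrix (Fin 2) (Fin 2) R) (hb : ∀ s : Matrix (Fin 2) (Fin 2) R, (s.map σ)ᵀ = s → ∃ z, b z = s)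
  (a : R) (ha : σ a = a) (v : (Fin n'' → FiniteAdeleRing (𝓞 (Fp L)) (Fp L)) → Fin 2 → R)
  (hu : ∀ z, IsLocallyConstant fun x => ((ψ (π (b z) (a • Matrix.vecMulVec (⇑σ ∘ v x) (v x))) : Circle) : ℂ))
  (hρm : ∀ (z : Z) (φ : FinSB (Fp L) (Fin n'')),
    ((ρf z φ : FinSB (Fp L) (Fin n'')) : (Fin n'' → FiniteAdeleRing (𝓞 (Fp L)) (Fp L)) → ℂ) =
      (fun x => ((ψ (π (b z) (a • Matrix.vecMulVec (⇑σ ∘ v x) (v x))) : Circle) : ℂ)) * φ)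
  (βloc : Matrix (Fin 2) (Fin 2) R) (hherm : (βloc.map σ)ᵀ = βloc) (hdet : βloc.det ≠ 0)
  (χ : Z →* ℂˣ) (hχ : ∀ z, ((χ z : ℂˣ) : ℂ) = ((ψ (π (b z) βloc) : Circle) : ℂ))
  -- (iii) the embedding `ι : Z → N_Δ(𝔸)` and the character match `χ = ψ_S ∘ ι` (the Weil∕model letter itself is `hκ` in the heads below)
  (ι : Z → unipDelta L e dV hdV dW hdW)
  (hχS : ∀ z : Z, ((χ z : ℂˣ) : ℂ) = (unipDeltaChar L e dV hdV dW hdW S (((ι z : unipDelta L e dV hdV dW hdW)) : HA L e dV hdV dW hdW) : ℂ))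

include hBl hPB hcf hβ hβtop hσ hσF hπ hψ hb ha hu hρm hherm hdet hχ hχS

set_option maxHeartbeats 1000000 in -- idem
/-- **`Λ_S ≡ 0`, GLOBAL-INTERTWINER FORM** — the instantiable head: for ANY linear automorphism `Tg` of `𝒮(𝔸^{n″})` such that, in the `Tg`-model, every
`ι z` acts on pure tensors by the σ-explicit multiplier model `ρf z` in the finite slot (`hκ` — at the datum: `Tg := ω(r_F κ_n)` read on the line pair, ★ (K-f) +
★ `coe_toOp_adelicSiegelLift`, census (B1c′)), the `S`-th Fourier coefficient of the doubled line theta lift vanishes at `1` for every `Φ`.  Proof: `Λ^κ := Λ_S ∘ Tg⁻¹`;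
`φ ↦ Λ^κ(Φ_∞ ⊗ φ)` is `(Z, χ)`-semi-invariant for `ρf` (`hκ` + ★ p862821 quasi-invariance of `Λ_S` at the vector `Tg⁻¹(Φ_∞ ⊗ φ)` + `hχS`), hence `0` (★ U2a σ-twin);
pure tensors generate, so `Λ^κ = 0`, and `Λ_S Φ = Λ^κ (Tg Φ) = 0`. [cite: Rallis1984, §4] [cite: Kudla1986, proof of Thm. 2.8] [cite: KudlaRallis1994, §3]
[cite: Weil1964, Chap. I n° 13, Chap. III n° 37–38] -/
theorem fourierCoeffDelta_thetaLift_eq_zero_of_finLineModel_conj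
    (Tg : ↥(piSchwartzBruhat (Fp L) (Fin n'')) ≃ₗ[ℂ] ↥(piSchwartzBruhat (Fp L) (Fin n'')))
    (hκ : ∀ (z : Z) (Φinf : 𝓢((Fin n'' → mixedSpace (Fp L)), ℂ)) (φ : FinSB (Fp L) (Fin n'')),
      Tg (pairRep (Fp L) L (IsCMField.complexConj L) (n + n) 1 e₁ (Matrix.diagonal (dD L e dV hdV dW hdW)) (JW (Fp L) L a')
          (chiSplittingLine L e₁ (dD L e dV hdV dW hdW) (dD_conj L e dV hdV dW hdW) (dD_ne_zero L e dV hdV dW hdW hdV0 hdW0)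
            (toHeckeCharacter L lam) (isUnitary_toHeckeCharacter L lam)
            ((isOscillatorChar_toHeckeCharacter_iff lam).mpr hlam) (TW (Fp L) a')
            (isUnit_det_TW (Fp L) a') (JW (Fp L) L a') (JW_eq (Fp L) L a'))
          (toDiagA L e dV hdV dW hdW ((ι z : unipDelta L e dV hdV dW hdW) : HA L e dV hdV dW hdW), 1)
          (Tg.symm (piSchwartzBruhatEquiv (Fp L) (Fin n'') (Φinf ⊗ₜ[ℂ] φ)))) =
        piSchwartzBruhatEquiv (Fp L) (Fin n'') (Φinf ⊗ₜ[ℂ] ρf z φ))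
    (Φ : piSchwartzBruhat (Fp L) (Fin n'')) :
    fourierCoeffDelta L e dV hdV dW hdW νN βw S (doubledLineThetaLift L e dV hdV dW hdW e₁ hdV0 hdW0 lam hlam a' hρ μW Φ fw) 1 = 0 := by
  -- the linear functional `Λ_S Φ := cfS ⟨Bl Φ, _⟩ 1` and its pointwise reading
  let ΛS : ↥(piSchwartzBruhat (Fp L) (Fin n'')) →ₗ[ℂ] ℂ :=
    LinearMap.proj (1 : HA L e dV hdV dW hdW) ∘ₗ cfS ∘ₗ LinearMap.codRestrict P Bl hPB
  have hΛS : ∀ Ψ : piSchwartzBruhat (Fp L) (Fin n''),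
      ΛS Ψ = fourierCoeffDelta L e dV hdV dW hdW νN βw S (doubledLineThetaLift L e dV hdV dW hdW e₁ hdV0 hdW0 lam hlam a' hρ μW Ψ fw) 1 := by
    intro Ψ
    have hBΨ : ((LinearMap.codRestrict P Bl hPB Ψ : ↥P) : HA L e dV hdV dW hdW → ℂ) =
        doubledLineThetaLift L e dV hdV dW hdW e₁ hdV0 hdW0 lam hlam a' hρ μW Ψ fw := by
      rw [LinearMap.codRestrict_apply]
      exact funext (hBl Ψ)
    change cfS (LinearMap.codRestrict P Bl hPB Ψ) 1 = _
    rw [hcf, hBΨ]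
  -- the transported functional `Λ^κ := Λ_S ∘ Tg⁻¹`
  let ΛK : ↥(piSchwartzBruhat (Fp L) (Fin n'')) →ₗ[ℂ] ℂ := ΛS ∘ₗ Tg.symm.toLinearMap
  have hΛK : ∀ Ψ, ΛK Ψ = ΛS (Tg.symm Ψ) := fun Ψ => rfl
  -- for each archimedean vector: `φ ↦ Λ^κ(Φ_∞ ⊗ φ)` is `(Z, χ)`-semi-invariant for the multiplier model, hence `0` by ★ U2a
  have hfin : ∀ (Φinf : 𝓢((Fin n'' → mixedSpace (Fp L)), ℂ)) (φ : FinSB (Fp L) (Fin n'')),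
      ΛK (piSchwartzBruhatEquiv (Fp L) (Fin n'') (Φinf ⊗ₜ[ℂ] φ)) = 0 := by
    intro Φinf φ
    let Λa : FinSB (Fp L) (Fin n'') →ₗ[ℂ] ℂ :=
      ΛK ∘ₗ (piSchwartzBruhatEquiv (Fp L) (Fin n'')).toLinearMap ∘ₗ TensorProduct.mk ℂ (𝓢((Fin n'' → mixedSpace (Fp L)), ℂ)) (FinSB (Fp L) (Fin n'')) Φinf
    have hΛa : ∀ φ' : FinSB (Fp L) (Fin n''), Λa φ' = ΛK (piSchwartzBruhatEquiv (Fp L) (Fin n'') (Φinf ⊗ₜ[ℂ] φ')) := fun φ' => rfl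
    have hsemi : ∀ (z : Z) (φ' : FinSB (Fp L) (Fin n'')), Λa (ρf z φ') = ((χ z : ℂˣ) : ℂ) • Λa φ' := by
      intro z φ'
      rw [hΛa, hΛa, ← hκ, hΛK, hΛK, LinearEquiv.symm_apply_apply, hΛS, hΛS]
      -- ★ p862821 quasi-invariance at the vector `Tg⁻¹ (Φ_∞ ⊗ φ′)`, which is itself a finite sum of pure tensors — apply it to EVERY vector:
      have hq : ∀ Ψ : piSchwartzBruhat (Fp L) (Fin n''),
          fourierCoeffDelta L e dV hdV dW hdW νN βw S
              (doubledLineThetaLift L e dV hdV dW hdW e₁ hdV0 hdW0 lam hlam a' hρ μW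
                (pairRep (Fp L) L (IsCMField.complexConj L) (n + n) 1 e₁ (Matrix.diagonal (dD L e dV hdV dW hdW)) (JW (Fp L) L a')
                  (chiSplittingLine L e₁ (dD L e dV hdV dW hdW) (dD_conj L e dV hdV dW hdW) (dD_ne_zero L e dV hdV dW hdW hdV0 hdW0)
                    (toHeckeCharacter L lam) (isUnitary_toHeckeCharacter L lam)
                    ((isOscillatorChar_toHeckeCharacter_iff lam).mpr hlam) (TW (Fp L) a')
                    (isUnit_det_TW (Fp L) a') (JW (Fp L) L a') (JW_eq (Fp L) L a'))
                  (toDiagA L e dV hdV dW hdW ((ι z : unipDelta L e dV hdV dW hdW) : HA L e dV hdV dW hdW), 1) Ψ) fw) 1 =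
            (unipDeltaChar L e dV hdV dW hdW S (((ι z : unipDelta L e dV hdV dW hdW)) : HA L e dV hdV dW hdW) : ℂ) *
              fourierCoeffDelta L e dV hdV dW hdW νN βw S (doubledLineThetaLift L e dV hdV dW hdW e₁ hdV0 hdW0 lam hlam a' hρ μW Ψ fw) 1 :=
        fun Ψ => fourierCoeffDelta_thetaLift_pairRep_unipDelta L e dV hdV dW hdW e₁ hdV0 hdW0 lam hlam a' hρ μW fw νN βw S hβ hβtop Ψ (ι z)
      rw [hq, hχS, smul_eq_mul]
    have h0 : Λa = 0 :=
      eq_zero_of_functional_rankTwo_conj σ hσ hσF π hπ ψ hψ ρf b hb a ha v βloc hu hρm χ hχ hherm hdet Λa hsemi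
    rw [← hΛa, h0, LinearMap.zero_apply]
  -- pure tensors generate `𝒮(𝔸^{n″})`, so `Λ^κ = 0`
  have hall : ∀ t : 𝓢((Fin n'' → mixedSpace (Fp L)), ℂ) ⊗[ℂ] FinSB (Fp L) (Fin n''), ΛK (piSchwartzBruhatEquiv (Fp L) (Fin n'') t) = 0 := by
    intro t
    induction t using TensorProduct.induction_on with
    | zero => rw [map_zero, map_zero]
    | tmul x y => exact hfin x y
    | add x y hx hy => rw [map_add, map_add, hx, hy, add_zero]
  -- `Λ_S Φ = Λ^κ (Tg Φ)` and `Tg Φ` is the image of a tensor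
  have hback : ΛS Φ = ΛK (Tg Φ) := by rw [hΛK, LinearEquiv.symm_apply_apply]
  have hΦ : Tg Φ = piSchwartzBruhatEquiv (Fp L) (Fin n'') ((piSchwartzBruhatEquiv (Fp L) (Fin n'')).symm (Tg Φ)) :=
    ((piSchwartzBruhatEquiv (Fp L) (Fin n'')).apply_symm_apply (Tg Φ)).symm
  rw [← hΛS, hback, hΦ]
  exact hall _

set_option maxHeartbeats 1000000 in -- idem
/-- **ROW `h2₂` OF FACE-D′ FOR THE THETA SIDE, GLOBAL-INTERTWINER FORM** — `cfS ∘ₗ codRestrict P T₂ hP₂ = 0` from the single model letter `hκ` (the κ-model of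
★ (K-f) read on pure tensors) and the σ-explicit line model's structure letters; ★ p862821 §2 ∘ `fourierCoeffDelta_thetaLift_eq_zero_of_finLineModel_conj`.
[cite: Rallis1984, §4] [cite: KudlaRallis1994, §3] [cite: Liu2021, App. B Prop. B.8 p. 104] -/
theorem h2Row_thetaSide_of_finLineModel_conj
    (Tg : ↥(piSchwartzBruhat (Fp L) (Fin n'')) ≃ₗ[ℂ] ↥(piSchwartzBruhat (Fp L) (Fin n'')))
    (hκ : ∀ (z : Z) (Φinf : 𝓢((Fin n'' → mixedSpace (Fp L)), ℂ)) (φ : FinSB (Fp L) (Fin n'')),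
      Tg (pairRep (Fp L) L (IsCMField.complexConj L) (n + n) 1 e₁ (Matrix.diagonal (dD L e dV hdV dW hdW)) (JW (Fp L) L a')
          (chiSplittingLine L e₁ (dD L e dV hdV dW hdW) (dD_conj L e dV hdV dW hdW) (dD_ne_zero L e dV hdV dW hdW hdV0 hdW0)
            (toHeckeCharacter L lam) (isUnitary_toHeckeCharacter L lam)
            ((isOscillatorChar_toHeckeCharacter_iff lam).mpr hlam) (TW (Fp L) a')
            (isUnit_det_TW (Fp L) a') (JW (Fp L) L a') (JW_eq (Fp L) L a'))
          (toDiagA L e dV hdV dW hdW ((ι z : unipDelta L e dV hdV dW hdW) : HA L e dV hdV dW hdW), 1)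
          (Tg.symm (piSchwartzBruhatEquiv (Fp L) (Fin n'') (Φinf ⊗ₜ[ℂ] φ)))) =
        piSchwartzBruhatEquiv (Fp L) (Fin n'') (Φinf ⊗ₜ[ℂ] ρf z φ))
    {D : Type*} [AddCommGroup D] [Module ℂ D] (𝓣 : D →ₗ[ℂ] piSchwartzBruhat (Fp L) (Fin n''))
    (T₂ : D →ₗ[ℂ] (HA L e dV hdV dW hdW → ℂ))
    (hT₂B : ∀ (x : D) (h : HA L e dV hdV dW hdW),
      T₂ x h = doubledLineThetaLift L e dV hdV dW hdW e₁ hdV0 hdW0 lam hlam a' hρ μW (𝓣 x) fw h)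
    (hP₂ : ∀ x, T₂ x ∈ P) :
    cfS ∘ₗ LinearMap.codRestrict P T₂ hP₂ = 0 :=
  coeff_comp_codRestrict_thetaFunctional_eq_zero L e dV hdV dW hdW e₁ hdV0 hdW0 lam hlam a' hρ μW fw νN βw S P cfS hcf 𝓣 T₂ hT₂B hP₂
    (fourierCoeffDelta_thetaLift_eq_zero_of_finLineModel_conj L e dV hdV dW hdW e₁ hdV0 hdW0 lam hlam a' hρ μW fw νN hβ hβtop S Bl hBl P hPB cfS hcf
      σ hσ hσF π hπ ψ hψ ρf b hb a ha v hu hρm βloc hherm hdet χ hχ ι hχS Tg hκ)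

end Summit.HodgeConjecture.HodgeConjecture.Cruxes.HLiu418.K2LiuFirstTermLineLiftRankRowModelConj

end
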